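import Literature.Topology.FourManifolds.SPC4HandlesLemma2Direct
import Literature.Topology.FourManifolds.PointPushDiffeotopy
import Literature.Topology.FourManifolds.CollarTheorem
import Literature.AlgebraicTopology.FundamentalGroup.IsotopyTrack
import HarnessLib

/-!
# Inner automorphisms of `π₁` of a `4`-dimensional `1`-handlebody are induced by diffeomorphisms

Topic `Literature/Topology/FourManifolds` (fact seat
`provefact-Literature.Topology.FourManifolds.lauden-f709dd520c`, Laudenbach–Poénaru's Lemma 2,
`laudenbachPoenaru_exists_diffeoExtends_mapOfEq_eq`).  Everything here is **proved**; no named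
facts.

For a compact connected `4`-manifold with boundary `V` with one `0`-handle and `k` `1`-handles,
a boundary datum `b` and a base point `z`, **every inner automorphism `x ↦ c x c⁻¹` of
`π₁(V, b.incl z)` is induced by a self-diffeomorphism of `V` fixing `b.incl z`**
(`exists_diffeomorph_mapOfEq_eq_conj`): `c` comes from a loop `γ` of the boundary
(`π₁(∂V) ≅ π₁(V)`, `HasHandleDecomposition.bijective_inclFundamentalGroupHom`, Laudenbach–Poénaru
p. 339 "`i_#` is bijective"); push `z` once around `γ` inside the boundary
(`exists_diffeotopy_apply_eq_trackPath_homotopic`), extend the end stage, which is diffeotopic to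
the identity, over `V` (`BoundaryData.diffeoExtends_of_isDiffeotopicToId_holds`, Hirsch Ch. 8 §2);
on `π₁` of the boundary the end stage acts by conjugation by the track
(`FundamentalGroup.mapOfEq_eq_conj_of_homotopy`, Hatcher's Lemma 1.19), hence so does the
extension on `π₁(V)`.  In the realisation of `Aut π₁` by diffeomorphisms (proof of Lemma 2,
p. 339) this disposes of the dependence of a handle slide on the path from the base point to the
`0`-handle (`closure_eq_top_of_conj_mul_nielsen_mem`, `NielsenClosureConj.lean`).

## References

* F. Laudenbach, V. Poénaru, *A note on 4-dimensional handlebodies*, Bull. Soc. Math. France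
  100 (1972), 337–344, §2, p. 339. [LaudenbachPoenaruBSMF1972]
* A. Hatcher, *Algebraic Topology* (2002), Lemma 1.19. [HatcherAT2002]
* M. W. Hirsch, *Differential Topology* (1976), Ch. 8 §1, Thm. 1.3; Ch. 8 §2, proof of Thm. 2.3.
  [HirschDT1976]
-/

open scoped Manifold ContDiff Topology unitInterval
open Set Function
open Literature.AlgebraicTopology Literature.AlgebraicTopology.FundamentalGroup

noncomputable section

namespace Literature.Topology.FourManifolds

universe u

/-! ### A map homotopic to the identity acts on `π₁` by conjugation by the track -/

section Conj

variable {N : Type*} [TopologicalSpace N]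

/-- Cast bookkeeping: conjugating by `τ : z ⟶ w` and casting the result back to `z` along
`z = w` is conjugating by the cast of `τ`. [folklore] -/
theorem Path.Homotopic.Quotient.cast_symm_trans_trans {z w : N} (e : z = w)
    (τ : Path.Homotopic.Quotient z w) (B : Path.Homotopic.Quotient z z) :
    ((τ.symm.trans B).trans τ).cast e e = (τ.cast rfl e).symm.trans (B.trans (τ.cast rfl e)) := by
  subst e
  rw [Path.Homotopic.Quotient.cast_rfl_rfl, Path.Homotopic.Quotient.cast_rfl_rfl,
    Path.Homotopic.Quotient.trans_assoc]

/-- **A map homotopic to the identity acts on the fundamental group by conjugation by the track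
of the base point** (Hatcher (2002), Lemma 1.19: `φ_{1*} = β_h φ_{0*}` with `φ₀ = id`).  If
`F : id ≃ g` is a homotopy, `g z = z`, and `τ` is the loop `t ↦ F(t, z)` at `z` (given as any path
agreeing with it pointwise), then for every `a ∈ π₁(N, z)`, `g_# a = [τ] · a · [τ]⁻¹` (Mathlib's
product on `FundamentalGroup`, `p * q = q.trans p`). [cite: HatcherAT2002, Lemma 1.19] -/
theorem FundamentalGroup.mapOfEq_eq_conj_of_homotopy {g : C(N, N)}
    (F : ContinuousMap.Homotopy (ContinuousMap.id N) g) {z : N} (hz : g z = z) (τ : Path z z)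
    (hτ : ∀ t, τ t = F (t, z)) (a : FundamentalGroup N z) :
    FundamentalGroup.mapOfEq g hz a =
      FundamentalGroup.fromPath (Path.Homotopic.Quotient.mk τ) * a *
        (FundamentalGroup.fromPath (Path.Homotopic.Quotient.mk τ))⁻¹ := by
  have e₁ : Path.cast (x := z) (y := g z) (F.evalAt z) rfl hz.symm = τ := by
    ext t
    exact (hτ t).symm
  induction a using Quotient.ind with
  | _ β =>
    rw [FundamentalGroup.mapOfEq_apply]
    change (Path.Homotopic.Quotient.map (Path.Homotopic.Quotient.mk β) g).cast hz.symm hz.symm = _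
    have hβ : β.map (map_continuous (ContinuousMap.id N)) = β := by ext; rfl
    rw [← Path.Homotopic.Quotient.mk_map, IsotopyTrack.mk_map_eq_of_homotopy F β, hβ]
    change ((((Path.Homotopic.Quotient.mk (F.evalAt z) : Path.Homotopic.Quotient z (g z))).symm.trans
        (Path.Homotopic.Quotient.mk β)).trans
          (Path.Homotopic.Quotient.mk (F.evalAt z) : Path.Homotopic.Quotient z (g z))).cast
        hz.symm hz.symm = _
    rw [Path.Homotopic.Quotient.cast_symm_trans_trans hz.symm, ← Path.Homotopic.Quotient.mk_cast,
      e₁, FundamentalGroup.mul_def, FundamentalGroup.mul_def, FundamentalGroup.inv_def]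
    rfl

end Conj

/-! ### Inner automorphisms are realised by diffeomorphisms fixing the base point -/

section Inner

variable {V : Type u} [TopologicalSpace V] [T2Space V] [SecondCountableTopology V]
  [CompactSpace V] [ConnectedSpace V] [ChartedSpace (EuclideanHalfSpace 4) V]
  [IsManifold (𝓡∂ 4) ∞ V]

/-- **Inner automorphisms of `π₁` of a `4`-dimensional `1`-handlebody are induced by based
self-diffeomorphisms.**  Let `V` be a compact connected smooth `4`-manifold with boundary having
a handle decomposition with one `0`-handle and `k` `1`-handles, `b` a boundary datum and
`z ∈ b.carrier`.  Then for every `c ∈ π₁(V, b.incl z)` there is a self-diffeomorphism `G` of `V`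
with `G (b.incl z) = b.incl z` and `G_# x = c x c⁻¹` for all `x`.  Proof: `c = (b.incl)_# [γ]`
for a loop `γ` of `b.carrier` at `z` (`i_#` onto, Laudenbach–Poénaru p. 339); push `z` around
`γ` by a diffeotopy `ψ` of `b.carrier` (Hirsch, Ch. 8 §1); `ψ₁` is diffeotopic to the identity,
so extends to `G` over `V` (Hirsch, Ch. 8 §2, `BoundaryData.diffeoExtends_of_isDiffeotopicToId_holds`);
`(ψ₁)_# = [γ](·)[γ]⁻¹` on `π₁(b.carrier, z)` (Hatcher, Lemma 1.19) and `G ∘ b.incl = b.incl ∘ ψ₁`.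
[cite: LaudenbachPoenaruBSMF1972, §2, p. 339] [cite: HirschDT1976, Ch. 8 §1, Thm. 1.3; Ch. 8 §2, proof of Thm. 2.3]
[cite: HatcherAT2002, Lemma 1.19] -/
theorem exists_diffeomorph_mapOfEq_eq_conj {k : ℕ} (hk : HasHandleDecomposition 3 V (handleCount 1 k))
    (b : BoundaryData (𝓡∂ 4) V (𝓡 3)) (z : b.carrier) (c : FundamentalGroup V (b.incl z)) :
    ∃ (G : V ≃ₘ⟮𝓡∂ 4, 𝓡∂ 4⟯ V) (hGz : G (b.incl z) = b.incl z),
      ∀ x : FundamentalGroup V (b.incl z),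
        FundamentalGroup.mapOfEq (⟨G, G.continuous⟩ : C(V, V)) hGz x = c * x * c⁻¹ := by
  haveI : T2Space b.carrier := b.isSmoothEmbedding.isEmbedding.t2Space
  -- `c` comes from a loop `γ` of the boundary
  obtain ⟨y, hy⟩ := (hk.bijective_inclFundamentalGroupHom b z).2 c
  set γ : Path z z := (FundamentalGroup.toPath y).out with hγ
  have hγy : FundamentalGroup.fromPath (Path.Homotopic.Quotient.mk γ) = y := by
    rw [hγ]
    exact Quotient.out_eq _
  -- push `z` around `γ` inside the boundary
  obtain ⟨D, K, -, -, -, -, -, h1, hhom⟩ :=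
    exists_diffeotopy_apply_eq_trackPath_homotopic (n := 3) γ isOpen_univ (subset_univ _)
  set ψ : b.carrier ≃ₘ⟮𝓡 3, 𝓡 3⟯ b.carrier := D.stage 1 with hψ
  have hψd : Diffeomorph.IsDiffeotopicToId ψ := ⟨D, rfl⟩
  have hψz : ψ z = z := h1
  -- extend the end stage over `V`
  obtain ⟨G, hG⟩ := BoundaryData.diffeoExtends_of_isDiffeotopicToId_holds 3 V b ψ hψd
  have hGincl : ∀ w, G (b.incl w) = b.incl (ψ w) := fun w => congrFun hG w
  have hGz : G (b.incl z) = b.incl z := by rw [hGincl, hψz]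
  refine ⟨G, hGz, fun x => ?_⟩
  obtain ⟨a, rfl⟩ := (hk.bijective_inclFundamentalGroupHom b z).2 x
  -- `G_# ∘ (b.incl)_# = (b.incl)_# ∘ ψ_#`
  let ψCM : C(b.carrier, b.carrier) := ⟨ψ, ψ.continuous⟩
  let GCM : C(V, V) := ⟨G, G.continuous⟩
  have hcomp : GCM.comp b.inclCM = b.inclCM.comp ψCM := ContinuousMap.ext fun w => hGincl w
  have hnat : FundamentalGroup.mapOfEq GCM hGz (b.inclFundamentalGroupHom z a) =
      b.inclFundamentalGroupHom z (FundamentalGroup.mapOfEq ψCM hψz a) := by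
    rw [BoundaryData.inclFundamentalGroupHom_apply, BoundaryData.inclFundamentalGroupHom_apply,
      ← FundamentalGroup.mapOfEq_comp_apply b.inclCM GCM rfl hGz a,
      FundamentalGroup.mapOfEq_congr hcomp, ← FundamentalGroup.mapOfEq_comp_apply ψCM b.inclCM hψz rfl a]
  -- `ψ_#` is conjugation by the class of the track, which is `[γ]`
  let F : ContinuousMap.Homotopy (ContinuousMap.id b.carrier) ψCM :=
    { toFun := fun p => D.toFun p.1 p.2
      continuous_toFun := D.contMDiff_uncurry_toFun.continuous.comp
        ((continuous_subtype_val.comp continuous_fst).prodMk continuous_snd)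
      map_zero_left := fun w => by
        show D.toFun ((0 : I) : ℝ) w = w
        rw [Set.Icc.coe_zero, D.toFun_zero]; rfl
      map_one_left := fun w => rfl }
  set T : Path z z := (D.trackPath z).cast rfl h1.symm with hTdef
  have hT : FundamentalGroup.fromPath (Path.Homotopic.Quotient.mk T) = y := by
    rw [Path.Homotopic.Quotient.eq.2 hhom, hγy]
  rw [hnat, FundamentalGroup.mapOfEq_eq_conj_of_homotopy F hψz T (fun t => rfl) a, hT, map_mul,
    map_mul, map_inv, hy]

end Inner

end Literature.Topology.FourManifolds
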